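import Literature.Topology.FourManifolds.TrisectionsExistence
import Literature.Topology.FourManifolds.HeegaardSplittingMorse
import HarnessLib

/-!
# Existence of trisections (Gay–Kirby 2016, Thm. 4), step 3: the outer sectors
# `X₁ = 0-handle ∪ 1-handles` and `X₃⁰ = 3-handles ∪ 4-handle` of a balanced handle decomposition

Topic `Literature/Topology/FourManifolds`; sibling of `Trisections.lean` and
`TrisectionsExistence.lean` (fact seat
`provefact-Literature.Topology.FourManifolds.exists_isBalancedGKTrisection`, Gay–Kirby's
existence theorem over the corrected predicate `Literature.Topology.FourManifolds.IsGKTrisection`).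
Everything in this file is **proved**; no named facts are introduced.

Gay–Kirby, *Trisecting 4-manifolds* (2016), §4, proof of Thm. 4 (arXiv p. 14): *"Start with a
handle decomposition of `X⁴` with one `0`-handle, `k₁` `1`-handles, `k₂` `2`-handles, `k₃`
`3`-handles and one `4`-handle.  Add cancelling `1`–`2` and `2`–`3` pairs if necessary so as to
arrange that `k₁ = k₃`.  Let `X₁` be the union of the `0`-handle and the `1`-handles."*, and
Lemma 14 with the first bullet of its proof (arXiv p. 13): *"Consider a handle decomposition of
a `4`-manifold `X⁴` with one `0`-handle, `k` `1`-handles, `g - k` `2`-handles, `k` `3`-handles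
and one `4`-handle.  Let `X₁` be the union of the `0`- and `1`-handles. […] `X₁` and `X₃` are
both diffeomorphic to `♮^k (S¹ × B³)`"* (`X₃` retracts onto the union of the `3`-handles and the
`4`-handle, which is `♮^k (S¹ × B³)` dually).

In the tree a handle decomposition of the closed `4`-manifold `X` is a self-indexing Morse
function `f` (`TrisectionsExistence.lean`: steps 1–2, the *balanced* nice Morse function with
`#Crit₀ = #Crit₄ = 1` and `#Crit₁ = #Crit₃`, are proved there from the tree's fact
`Literature.Topology.FourManifolds.exists_isMorse_isSelfIndexing 4`), "the union of the `0`-handle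
and the `1`-handles" is the regular sublevel set `X₁ = X^{3/2} = {f ≤ 3/2}`
(`Literature.Topology.FourManifolds.RegularSublevel`, `RegularLevelSplitting.lean`: a compact
smooth `4`-manifold with boundary `f⁻¹(3/2)`, smoothly embedded in `X` by the inclusion), "the
union of the `3`-handles and the `4`-handle" is the regular superlevel set
`X₃⁰ = {5/2 ≤ f}` (`Literature.Topology.FourManifolds.RegularSuperlevel`), and
"`≅ ♮^k (S¹ × B³)`" is read, exactly as in clause (ii) of `IsGKTrisection`, as: compact,
connected, (orientable,) with a handle decomposition with one `0`-handle and `k` `1`-handles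
(`Literature.Topology.FourManifolds.HasHandleDecomposition 3 · (handleCount 1 k)`; for orientable
pieces this is `♮^k (S¹ × B³)` by the classification of orientable `1`-handlebodies,
`OneHandlebodyClassification.lean`).  This file proves, in that reading:

* `IsMorse.isRegularLevel_nat_add_half` — the half-integer levels `m + 1/2` of a self-indexing
  Morse function are regular (any dimension);
* `hasHandleDecomposition_regularSublevel_three_halves_four`,
  `connectedSpace_regularSublevel_three_halves_four` — **`X₁ = {f ≤ 3/2}` is a connected
  `1`-handlebody with `#Crit₁(f)` `1`-handles** (adapted Morse function `f|X₁ - 1/2`; the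
  critical points below `3/2` are exactly those of index `0` and `1`; connected by uniqueness of
  the minimum, `RegularSublevel.connectedSpace`), orientable if `X` is
  (`RegularSublevel.isOrientable`);
* `hasHandleDecomposition_regularSuperlevel_five_halves_four`,
  `connectedSpace_regularSuperlevel_five_halves_four` — dually (turning `f` about, `7/2 - f` on
  `{5/2 ≤ f} = {5/2 - f ≤ 0}`, `Literature.Topology.FourManifolds.IsMorse.criticalSetOfIndex_const_sub`)
  **`X₃⁰ = {5/2 ≤ f}` is a connected `1`-handlebody with `#Crit₃(f)` `1`-handles**;
* `exists_outerSectors_of_exists_isMorse_isSelfIndexing` — the assembly with steps 1–2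
  (`Literature.Topology.FourManifolds.exists_isSelfIndexing_ncard_one_eq_ncard_three`): granted
  `exists_isMorse_isSelfIndexing 4`, every closed connected oriented smooth `4`-manifold carries
  a self-indexing Morse function whose outer pieces `{f ≤ 3/2}` and `{5/2 ≤ f}` are compact
  connected orientable `1`-handlebodies **with the same number `k` of `1`-handles** — the two
  outer sectors of Gay–Kirby's Lemma 14 before the middle region `{3/2 ≤ f ≤ 5/2}` is divided
  between `X₂` and `X₃` by a Heegaard splitting of `∂X₁` adapted to the attaching link of the
  `2`-handles (Lemma 14, hypotheses; not treated here), and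
  `exists_outerSectors_of_modelChart`, the same from Milnor's Assertion 6 alone
  (`Literature.Topology.FourManifolds.exists_isMorse_isSelfIndexing_of_modelChart`).

**Caveat recorded for the sequel.**  In the corrected predicate `IsGKTrisection` every sector has
a *corner chart* (`Literature.Topology.FourManifolds.IsCornerAt`: a linear image of the model
quadrant in a smooth chart of `X`) at each point of the central surface `F`, so that the sector
`X₁` of the final trisection is not the smooth domain `{f ≤ 3/2}` on the nose (whose boundary is
smooth through `F`) but a version of it bevelled along `F ⊂ ∂X₁`; the present file concerns the
smooth domain of Gay–Kirby's text.

## References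

* D. Gay, R. Kirby, *Trisecting 4-manifolds*, Geom. Topol. 20 (2016) 3097–3132
  (arXiv:1205.1565): §4, Lemma 14 and its proof (first bullet), proof of Thm. 4. [GayKirby2016]
* J. Milnor, *Morse theory*, Ann. of Math. Studies 51 (1963), Thm. 3.1 (`Mᵃ` is a smooth
  manifold with boundary), §3. [Milnor1963]
* J. Milnor, *Lectures on the h-cobordism theorem* (1965), Def. 4.9 (self-indexing), proof of
  Thm. 9.1 (turning about). [MilnorHCobordism1965]
-/

open scoped Manifold ContDiff Topology
open Set Function

noncomputable section

universe u

namespace Literature.Topology.FourManifolds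

/-! ### Half-integer levels of a self-indexing Morse function are regular -/

section General

variable {k : ℕ} {M : Type u} [TopologicalSpace M] [ChartedSpace (EuclideanSpace ℝ (Fin (k + 1))) M] {f : M → ℝ}

/-- The half-integer levels `m + 1/2` of a self-indexing Morse function on a manifold without
boundary are regular levels (a self-indexing function takes only integer critical values).
[cite: MilnorHCobordism1965, Def. 4.9] -/
theorem IsMorse.isRegularLevel_nat_add_half (hf : IsMorse (𝓡 (k + 1)) f)
    (hsi : IsSelfIndexing (𝓡 (k + 1)) f) (m : ℕ) :
    IsRegularLevel (𝓡 (k + 1)) f (m + 1 / 2) :=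
  hf.isRegularLevel fun _ hz =>
    hsi.apply_ne_of_lt_of_lt (m := m) (by norm_num) (by norm_num) hz

end General

/-! ### Dimension four: the outer sectors of a balanced handle decomposition -/

section DimFour

variable {X : Type u} [TopologicalSpace X] [ChartedSpace (EuclideanSpace ℝ (Fin 4)) X] [IsManifold (𝓡 4) ∞ X]
  [CompactSpace X] {f : X → ℝ}

omit [IsManifold (𝓡 4) ∞ X] [CompactSpace X] in
/-- `3/2` is a regular level of a self-indexing Morse function on a `4`-manifold.
[cite: GayKirby2016, §4, proof of Thm. 4] -/
theorem IsMorse.isRegularLevel_three_halves_four (hf : IsMorse (𝓡 4) f)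
    (hsi : IsSelfIndexing (𝓡 4) f) : IsRegularLevel (𝓡 4) f (3 / 2) :=
  hf.isRegularLevel fun _ hz =>
    hsi.apply_ne_of_lt_of_lt (m := 1) (by norm_num) (by norm_num) hz

omit [IsManifold (𝓡 4) ∞ X] [CompactSpace X] in
/-- `5/2` is a regular level of a self-indexing Morse function on a `4`-manifold.
[cite: GayKirby2016, §4, proof of Thm. 4] -/
theorem IsMorse.isRegularLevel_five_halves_four (hf : IsMorse (𝓡 4) f)
    (hsi : IsSelfIndexing (𝓡 4) f) : IsRegularLevel (𝓡 4) f (5 / 2) :=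
  hf.isRegularLevel fun _ hz =>
    hsi.apply_ne_of_lt_of_lt (m := 2) (by norm_num) (by norm_num) hz

omit [CompactSpace X] in
/-- **`X₁ = {f ≤ 3/2}`, "the union of the `0`-handle and the `1`-handles", is a `1`-handlebody
with `#Crit₁(f)` `1`-handles**: for a self-indexing Morse function `f` with exactly one critical
point of index `0` on a closed `4`-manifold, the regular sublevel set `X^{3/2}` carries the
adapted Morse function `f|X₁ + (1 - 3/2)` with one critical point of index `0`, `#Crit₁(f)` of
index `1` and no others (`HasHandleDecomposition 3 X₁ (handleCount 1 #Crit₁(f))` — the tree's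
reading of "`X₁ ≅ ♮^k (S¹ × B³)`"). [cite: GayKirby2016, §4, Lemma 14 (proof, first bullet) and proof of Thm. 4] -/
theorem hasHandleDecomposition_regularSublevel_three_halves_four (hf : IsMorse (𝓡 4) f)
    (hsi : IsSelfIndexing (𝓡 4) f) (h0 : (criticalSetOfIndex (𝓡 4) f 0).ncard = 1)
    (h : IsRegularLevel (𝓡 4) f (3 / 2)) :
    HasHandleDecomposition 3 (RegularSublevel h)
      (handleCount 1 (criticalSetOfIndex (𝓡 4) f 1).ncard) := by
  have hd := RegularSublevel.hasHandleDecomposition hf h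
  have hfun : (fun i => (criticalSetOfIndex (𝓡 4) f i ∩ f ⁻¹' Iic (3 / 2 : ℝ)).ncard) =
      handleCount 1 (criticalSetOfIndex (𝓡 4) f 1).ncard := by
    funext i
    rcases Nat.lt_or_ge i 2 with hi | hi
    · interval_cases i
      · rw [hsi.criticalSetOfIndex_inter_preimage_Iic_of_le (by norm_num), h0]
        rfl
      · rw [hsi.criticalSetOfIndex_inter_preimage_Iic_of_le (by norm_num)]
        rfl
    · have hi' : (3 / 2 : ℝ) < i := by
        have : (2 : ℝ) ≤ i := by exact_mod_cast hi
        linarith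
      rw [hsi.criticalSetOfIndex_inter_preimage_Iic_of_lt hi', ncard_empty, handleCount,
        if_neg (by omega), if_neg (by omega)]
  rw [hfun] at hd
  exact hd

omit [IsManifold (𝓡 4) ∞ X] in
/-- **`X₁ = {f ≤ 3/2}` is connected** (uniqueness of the minimum: the `0`-handle, to which the
`1`-handles are attached). [cite: GayKirby2016, §4, Lemma 14 (proof, first bullet)] -/
theorem connectedSpace_regularSublevel_three_halves_four (hsi : IsSelfIndexing (𝓡 4) f)
    (h0 : (criticalSetOfIndex (𝓡 4) f 0).ncard = 1) (h : IsRegularLevel (𝓡 4) f (3 / 2)) :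
    ConnectedSpace (RegularSublevel h) := by
  obtain ⟨x₀, hx₀⟩ := Set.ncard_eq_one.1 h0
  have h0' : (criticalSetOfIndex (𝓡 4) f 0).Subsingleton := by
    rw [hx₀]; exact subsingleton_singleton
  have hx₀mem : x₀ ∈ criticalSetOfIndex (𝓡 4) f 0 := by rw [hx₀]; exact mem_singleton _
  have hfx₀ : f x₀ = 0 := by
    have := hsi.apply_eq_of_mem_criticalSetOfIndex hx₀mem
    simpa using this
  exact RegularSublevel.connectedSpace h h0' ⟨x₀, by rw [hfx₀]; norm_num⟩

omit [CompactSpace X] in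
/-- **`X₃⁰ = {5/2 ≤ f}`, "the union of the `3`-handles and the `4`-handle", is a `1`-handlebody
with `#Crit₃(f)` `1`-handles** (dually: the regular superlevel set `{5/2 ≤ f} = {5/2 - f ≤ 0}`
carries the adapted Morse function `7/2 - f`, whose critical points of index `i` are those of
`f` of index `4 - i`, `Literature.Topology.FourManifolds.IsMorse.criticalSetOfIndex_const_sub`;
for a self-indexing `f` with exactly one critical point of index `4` these are one point of
index `0` and `#Crit₃(f)` points of index `1`).
[cite: GayKirby2016, §4, Lemma 14 (proof, first bullet) and proof of Thm. 4]
[cite: MilnorHCobordism1965, proof of Thm. 9.1 (turning about)] -/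
theorem hasHandleDecomposition_regularSuperlevel_five_halves_four (hf : IsMorse (𝓡 4) f)
    (hsi : IsSelfIndexing (𝓡 4) f) (h4 : (criticalSetOfIndex (𝓡 4) f 4).ncard = 1)
    (h : IsRegularLevel (𝓡 4) f (5 / 2)) :
    HasHandleDecomposition 3 (RegularSuperlevel h)
      (handleCount 1 (criticalSetOfIndex (𝓡 4) f 3).ncard) := by
  have hd := RegularSublevel.hasHandleDecomposition (hf.const_sub (5 / 2)) h.const_sub
  have hrank : Module.finrank ℝ (EuclideanSpace ℝ (Fin 4)) = 4 := finrank_euclideanSpace_fin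
  have hcs : ∀ {i : ℕ}, i ≤ 4 → criticalSetOfIndex (𝓡 4) (fun y => 5 / 2 - f y) i =
      criticalSetOfIndex (𝓡 4) f (4 - i) := fun {i} hi => by
    rw [hf.criticalSetOfIndex_const_sub (5 / 2) (by rw [hrank]; exact hi), hrank]
  have hfun : (fun i => (criticalSetOfIndex (𝓡 4) (fun y => 5 / 2 - f y) i ∩
      (fun y => 5 / 2 - f y) ⁻¹' Iic (0 : ℝ)).ncard) =
      handleCount 1 (criticalSetOfIndex (𝓡 4) f 3).ncard := by
    funext i
    rcases Nat.lt_or_ge i 5 with hi | hi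
    · interval_cases i
      · rw [hcs (by norm_num), hsi.criticalSetOfIndex_inter_superlevel_of_le (by norm_num), h4]
        rfl
      · rw [hcs (by norm_num), hsi.criticalSetOfIndex_inter_superlevel_of_le (by norm_num)]
        rfl
      · rw [hcs (by norm_num), hsi.criticalSetOfIndex_inter_superlevel_of_lt (by norm_num),
          ncard_empty]
        rfl
      · rw [hcs (by norm_num), hsi.criticalSetOfIndex_inter_superlevel_of_lt (by norm_num),
          ncard_empty]
        rfl
      · rw [hcs (by norm_num), hsi.criticalSetOfIndex_inter_superlevel_of_lt (by norm_num),
          ncard_empty]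
        rfl
    · rw [criticalSetOfIndex_eq_empty_of_finrank_lt (by rw [hrank]; omega), empty_inter,
        ncard_empty, handleCount, if_neg (by omega), if_neg (by omega)]
  rw [hfun] at hd
  exact hd

/-- **`X₃⁰ = {5/2 ≤ f}` is connected** (uniqueness of the maximum).
[cite: GayKirby2016, §4, Lemma 14 (proof, first bullet)] -/
theorem connectedSpace_regularSuperlevel_five_halves_four (hf : IsMorse (𝓡 4) f)
    (hsi : IsSelfIndexing (𝓡 4) f) (h4 : (criticalSetOfIndex (𝓡 4) f 4).ncard = 1)
    (h : IsRegularLevel (𝓡 4) f (5 / 2)) : ConnectedSpace (RegularSuperlevel h) := by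
  obtain ⟨x₄, hx₄⟩ := Set.ncard_eq_one.1 h4
  have h4' : (criticalSetOfIndex (𝓡 4) f 4).Subsingleton := by
    rw [hx₄]; exact subsingleton_singleton
  have hx₄mem : x₄ ∈ criticalSetOfIndex (𝓡 4) f 4 := by rw [hx₄]; exact mem_singleton _
  have hfx₄ : f x₄ = 4 := by
    have := hsi.apply_eq_of_mem_criticalSetOfIndex hx₄mem
    simpa using this
  exact RegularSublevel.connectedSpace_superlevel hf h h4' ⟨x₄, by rw [hfx₄]; norm_num⟩

omit [IsManifold (𝓡 4) ∞ X] [CompactSpace X] in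
/-- The two outer pieces are disjoint: `{f ≤ 3/2} ∩ {5/2 ≤ f} = ∅` (they are separated by the
middle region `{3/2 ≤ f ≤ 5/2}` containing the `2`-handles). [cite: GayKirby2016, §4, Lemma 14] -/
theorem range_incl_three_halves_inter_range_incl_five_halves
    (h₁ : IsRegularLevel (𝓡 4) f (3 / 2)) (h₂ : IsRegularLevel (𝓡 4) f (5 / 2)) :
    range (RegularSublevel.incl h₁) ∩ range (RegularSublevel.incl h₂.const_sub) = ∅ := by
  rw [RegularSublevel.range_incl, RegularSublevel.range_incl]
  refine eq_empty_of_forall_notMem fun x hx => ?_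
  have hx₁ : f x ≤ 3 / 2 := hx.1
  have hx₂ : 5 / 2 - f x ≤ 0 := hx.2
  linarith

end DimFour

/-! ### Assembly with steps 1–2: the outer sectors of a balanced handle decomposition -/

section Assembly

/-- **The outer sectors of Gay–Kirby's construction** (proof of Thm. 4 with Lemma 14, first
bullet), granted the tree's fact `exists_isMorse_isSelfIndexing 4`: every closed connected
oriented smooth `4`-manifold `X` carries a self-indexing Morse function `f` with one critical
point of index `0`, one of index `4` and `k` of each of the indices `1` and `3`
(`Literature.Topology.FourManifolds.exists_isSelfIndexing_ncard_one_eq_ncard_three`), and then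
`X₁ = {f ≤ 3/2}` (the `0`-handle and the `1`-handles) and `X₃⁰ = {5/2 ≤ f}` (the `3`-handles
and the `4`-handle) are disjoint compact connected orientable smooth `4`-manifolds with
boundary, smoothly embedded in `X`, each with a handle decomposition with one `0`-handle and
**the same number `k`** of `1`-handles (both "`≅ ♮^k (S¹ × B³)`").
[cite: GayKirby2016, §4, proof of Thm. 4 and Lemma 14 (proof, first bullet)] -/
theorem exists_outerSectors_of_exists_isMorse_isSelfIndexing
    (hSI : FourManifolds.exists_isMorse_isSelfIndexing.{u} 4) (X : Type u) [TopologicalSpace X]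
    [T2Space X] [SecondCountableTopology X] [ChartedSpace (EuclideanSpace ℝ (Fin 4)) X] [IsManifold (𝓡 4) ∞ X]
    [CompactSpace X] [ConnectedSpace X] (o : SmoothOrientation (𝓡 4) X) :
    ∃ (f : X → ℝ) (k : ℕ) (h₁ : IsRegularLevel (𝓡 4) f (3 / 2))
      (h₂ : IsRegularLevel (𝓡 4) f (5 / 2)),
      IsMorse (𝓡 4) f ∧ IsSelfIndexing (𝓡 4) f ∧
      (criticalSetOfIndex (𝓡 4) f 0).ncard = 1 ∧ (criticalSetOfIndex (𝓡 4) f 4).ncard = 1 ∧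
      (criticalSetOfIndex (𝓡 4) f 1).ncard = k ∧ (criticalSetOfIndex (𝓡 4) f 3).ncard = k ∧
      -- `X₁ = {f ≤ 3/2}`
      ConnectedSpace (RegularSublevel h₁) ∧ IsOrientable (𝓡∂ 4) (RegularSublevel h₁) ∧
      HasHandleDecomposition 3 (RegularSublevel h₁) (handleCount 1 k) ∧
      Manifold.IsSmoothEmbedding (𝓡∂ 4) (𝓡 4) ∞ (RegularSublevel.incl h₁) ∧
      range (RegularSublevel.incl h₁) = f ⁻¹' Iic (3 / 2) ∧
      -- `X₃⁰ = {5/2 ≤ f}`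
      ConnectedSpace (RegularSuperlevel h₂) ∧ IsOrientable (𝓡∂ 4) (RegularSuperlevel h₂) ∧
      HasHandleDecomposition 3 (RegularSuperlevel h₂) (handleCount 1 k) ∧
      Manifold.IsSmoothEmbedding (𝓡∂ 4) (𝓡 4) ∞ (RegularSublevel.incl h₂.const_sub) ∧
      range (RegularSublevel.incl h₂.const_sub) = (fun y => 5 / 2 - f y) ⁻¹' Iic 0 ∧
      range (RegularSublevel.incl h₁) ∩ range (RegularSublevel.incl h₂.const_sub) = ∅ := by
  obtain ⟨f, hf, hsi, h0, h4, h13⟩ := exists_isSelfIndexing_ncard_one_eq_ncard_three hSI X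
  have h₁ := hf.isRegularLevel_three_halves_four hsi
  have h₂ := hf.isRegularLevel_five_halves_four hsi
  have hX : IsOrientable (𝓡 4) X := ⟨o⟩
  refine ⟨f, (criticalSetOfIndex (𝓡 4) f 1).ncard, h₁, h₂, hf, hsi, h0, h4, rfl, h13.symm,
    connectedSpace_regularSublevel_three_halves_four hsi h0 h₁,
    RegularSublevel.isOrientable h₁ hX,
    hasHandleDecomposition_regularSublevel_three_halves_four hf hsi h0 h₁,
    RegularSublevel.isSmoothEmbedding_incl h₁, RegularSublevel.range_incl h₁,
    connectedSpace_regularSuperlevel_five_halves_four hf hsi h4 h₂,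
    RegularSublevel.isOrientable h₂.const_sub hX, ?_,
    RegularSublevel.isSmoothEmbedding_incl h₂.const_sub, RegularSublevel.range_incl h₂.const_sub,
    range_incl_three_halves_inter_range_incl_five_halves h₁ h₂⟩
  rw [h13]
  exact hasHandleDecomposition_regularSuperlevel_five_halves_four hf hsi h4 h₂

/-- **The outer sectors from Milnor's Assertion 6 alone**: the previous statement with the
tree's fact `exists_isMorse_isSelfIndexing 4` replaced by its single remaining leaf
`Cobordism.Milnor1965_cancellation_modelChart`
(`Literature.Topology.FourManifolds.exists_isMorse_isSelfIndexing_of_modelChart`).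
[cite: GayKirby2016, §4, proof of Thm. 4 and Lemma 14 (proof, first bullet)]
[cite: MilnorHCobordism1965, proof of Thm. 5.4, Assertion 6 (PDF pp. 30–32)] -/
theorem exists_outerSectors_of_modelChart
    (hE : Cobordism.Milnor1965_cancellation_modelChart.{u}) (X : Type u) [TopologicalSpace X]
    [T2Space X] [SecondCountableTopology X] [ChartedSpace (EuclideanSpace ℝ (Fin 4)) X] [IsManifold (𝓡 4) ∞ X]
    [CompactSpace X] [ConnectedSpace X] (o : SmoothOrientation (𝓡 4) X) :
    ∃ (f : X → ℝ) (k : ℕ) (h₁ : IsRegularLevel (𝓡 4) f (3 / 2))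
      (h₂ : IsRegularLevel (𝓡 4) f (5 / 2)),
      IsMorse (𝓡 4) f ∧ IsSelfIndexing (𝓡 4) f ∧
      (criticalSetOfIndex (𝓡 4) f 0).ncard = 1 ∧ (criticalSetOfIndex (𝓡 4) f 4).ncard = 1 ∧
      (criticalSetOfIndex (𝓡 4) f 1).ncard = k ∧ (criticalSetOfIndex (𝓡 4) f 3).ncard = k ∧
      ConnectedSpace (RegularSublevel h₁) ∧ IsOrientable (𝓡∂ 4) (RegularSublevel h₁) ∧
      HasHandleDecomposition 3 (RegularSublevel h₁) (handleCount 1 k) ∧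
      Manifold.IsSmoothEmbedding (𝓡∂ 4) (𝓡 4) ∞ (RegularSublevel.incl h₁) ∧
      range (RegularSublevel.incl h₁) = f ⁻¹' Iic (3 / 2) ∧
      ConnectedSpace (RegularSuperlevel h₂) ∧ IsOrientable (𝓡∂ 4) (RegularSuperlevel h₂) ∧
      HasHandleDecomposition 3 (RegularSuperlevel h₂) (handleCount 1 k) ∧
      Manifold.IsSmoothEmbedding (𝓡∂ 4) (𝓡 4) ∞ (RegularSublevel.incl h₂.const_sub) ∧
      range (RegularSublevel.incl h₂.const_sub) = (fun y => 5 / 2 - f y) ⁻¹' Iic 0 ∧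
      range (RegularSublevel.incl h₁) ∩ range (RegularSublevel.incl h₂.const_sub) = ∅ :=
  exists_outerSectors_of_exists_isMorse_isSelfIndexing
    (exists_isMorse_isSelfIndexing_of_modelChart hE 4) X o

end Assembly

end Literature.Topology.FourManifolds

end
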